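import Literature.Probability.LatticeModels.AnnealedDeviceCorrMeasurable
import Literature.Probability.LatticeModels.AnnealedDeviceCorrGKS
import HarnessLib

/-!
# The annealed device correlators are bounded below by the void probability

Topic `Probability/LatticeModels`; theorem-only companion of `AnnealedDeviceCorr.lean`,
`AnnealedDeviceCorrGKS.lean` (GKS I for the device integrand) and `AnnealedDeviceCorrMeasurable.lean`
(integrability of the device integrand), for the crux `DeviceWeylUniversality` of route
`CriticalPhenomena/Ising3DConformalLimit/ConformalPoissonDevice` (stmt-CriticalPhenomena-4722).

* `annealedDeviceCorr_ge_exp` — for a Poisson law `P` with finite intensity `ν ≪ volume` and `β ≥ 0`,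
  `e^{-ν(ℝᵈ)} ≤ annealedDeviceCorr P β n x` for EVERY `n`: the integrand is `≥ 0` (GKS I,
  `deviceGibbsAverage_nonneg`), `= 1` on the empty configuration, and — now that it is known to be
  integrable (`integrable_deviceGibbsAverage`) — its integral dominates the void probability
  `P{ω = ∅} = e^{-ν(ℝᵈ)}` (Last–Penrose 2017, Def. 3.1). In particular `0 < annealedDeviceCorr P β n x`
  (`annealedDeviceCorr_pos`): the device correlators of the route are genuine, non-vanishing
  expectations (no Bochner junk).

No definitions, no named facts.
-/

noncomputable section

open scoped Classical
open MeasureTheory Set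
open Literature.Analysis.FunctionSpaces

namespace Literature.Probability.LatticeModels

variable {d : ℕ}

/-- **Void-probability lower bound**: for a Poisson law with finite intensity `ν` having a Lebesgue
density and a ferromagnetic coupling `β ≥ 0`, `e^{-ν(ℝᵈ)} ≤ annealedDeviceCorr P β n x` for every `n`
(GKS I pointwise, the empty configuration contributes `1`, integrability of the device integrand).
[cite: LastPenrose2017, Def 3.1] -/
theorem annealedDeviceCorr_ge_exp [Nontrivial (EuclideanSpace ℝ (Fin d))]
    {ν : Measure (EuclideanSpace ℝ (Fin d))} [IsFiniteMeasure ν]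
    (hν : ν ≪ (volume : Measure (EuclideanSpace ℝ (Fin d))))
    {P : Measure (PointConfig (EuclideanSpace ℝ (Fin d)))} (hP : IsPoissonPointProcess ν P)
    {β : ℝ} (hβ : 0 ≤ β) (n : ℕ) (x : Fin n → EuclideanSpace ℝ (Fin d)) :
    Real.exp (-(ν Set.univ).toReal) ≤ annealedDeviceCorr P β n x := by
  haveI := hP.isProbabilityMeasure
  set V : Set (PointConfig (EuclideanSpace ℝ (Fin d))) :=
    {ω | (ω : Set (EuclideanSpace ℝ (Fin d))) = ∅} with hV
  -- the void probability as the integral of an indicator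
  have hvoid : ∫ ω, (V.indicator 1 ω : ℝ) ∂P = Real.exp (-(ν Set.univ).toReal) := by
    rw [hV, integral_indicator_one measurableSet_setOf_coe_eq_empty,
      ← hP.measureReal_count_eq_zero MeasurableSet.univ (measure_ne_top ν _)]
    congr 1
    ext ω
    simp [PointConfig.count]
  have hVm : MeasurableSet V := hV ▸ measurableSet_setOf_coe_eq_empty
  rw [← hvoid, annealedDeviceCorr_eq_integral]
  refine integral_mono ((integrable_indicator_iff hVm).2 (integrable_const (1 : ℝ)).integrableOn)
    (integrable_deviceGibbsAverage hν hP β n x) fun ω => ?_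
  -- pointwise: the indicator of `{∅}` is below the (non-negative) device integrand
  by_cases hω : (ω : Set (EuclideanSpace ℝ (Fin d))) = ∅
  · have hmem : ω ∈ V := hω
    simp only [Set.indicator_of_mem hmem, Pi.one_apply]
    rw [deviceGibbsAverage_of_eq_empty β n x hω]
  · have hmem : ω ∉ V := hω
    simp only [Set.indicator_of_notMem hmem]
    exact deviceGibbsAverage_nonneg hβ n x ω

/-- **The annealed device correlators are strictly positive** (`β ≥ 0`, Poisson law with finite
intensity having a density): `0 < annealedDeviceCorr P β n x`. [cite: LastPenrose2017, Def 3.1] -/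
theorem annealedDeviceCorr_pos [Nontrivial (EuclideanSpace ℝ (Fin d))]
    {ν : Measure (EuclideanSpace ℝ (Fin d))} [IsFiniteMeasure ν]
    (hν : ν ≪ (volume : Measure (EuclideanSpace ℝ (Fin d))))
    {P : Measure (PointConfig (EuclideanSpace ℝ (Fin d)))} (hP : IsPoissonPointProcess ν P)
    {β : ℝ} (hβ : 0 ≤ β) (n : ℕ) (x : Fin n → EuclideanSpace ℝ (Fin d)) :
    0 < annealedDeviceCorr P β n x :=
  (Real.exp_pos _).trans_le (annealedDeviceCorr_ge_exp hν hP hβ n x)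

end Literature.Probability.LatticeModels

end
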